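import Summits.ValiantsHypothesis.ValiantsHypothesis.Theses.LacunarySymmetroid
import Summits.ValiantsHypothesis.ValiantsHypothesis.Theorems.LacunarySymmetroidMatrixDescartesCensusCurrency

/-!
# `MatrixDescartes` — format-level Descartes-extremality for ALL formats is incompatible with the crux

HONEST FRAMING.  Object-search cell `pub-symmetroid`, crux `Theses.LacunarySymmetroid.MatrixDescartes`
(stmt-ValiantsHypothesis-18050).  The cell's census found every DECIDED format Descartes-extremal
(`ζ(m,K) = D(m,K) = C(m+K−1,m) − 1`, kernel rows in the CensusTable file) and its `STRUCTURE.md` §2.2 registers the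
format-level sentence «`ζ_sym(m,K) = C(m+K−1,m) − 1` for all `m, K`» as the conjecture to falsify.  This file records
the elementary but important bookkeeping fact that this sentence, READ LITERALLY FOR ALL FORMATS, REFUTES the crux:
Descartes-extremality of the formats `(K², K)` alone gives `ζ ≥ K^(K−1)`, while `MatrixDescartes` (with `c = q = 2`)
caps `(2ζ+1)² ≤ 2^(K⌊log₂K⌋) = K^K` at `m = K² ≤ 2^((log₂K+2)²)` for `K` a large power of two.  Equivalently:
`MatrixDescartes` FORCES Descartes-deficiency at some quasi-polynomial formats — about which the finite census
(`m ≤ 7`, `K ≤ 10`) says nothing.  Nothing here proves or refutes the crux; the hypothesis is the (unproved, and in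
this generality implausible) lower half of the format-level law.  No claim about `VP ≠ VNP`.
-/

-- `Summit.ValiantsHypothesis.ValiantsHypothesis.…` repeats a component by the D-0017 layout
-- (single-conjunct summit), which the `dupNamespace` linter flags; the name is mandated.
set_option linter.dupNamespace false

namespace Summit.ValiantsHypothesis.ValiantsHypothesis.Theorems.LacunarySymmetroidMatrixDescartes.Census

open Summit.ValiantsHypothesis.ValiantsHypothesis.Theorems.MatrixDescartes.Negative (PosRootLawAt)
open Summit.ValiantsHypothesis.ValiantsHypothesis.Theses.LacunarySymmetroid (MatrixDescartes)

/-- Rows are monotone in the bound. [folklore] -/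
theorem posRootLawAt_mono {m K B B' : ℕ} (hBB' : B ≤ B') (h : PosRootLawAt m K B) :
    PosRootLawAt m K B' :=
  fun d S hS => (h d S hS).trans hBB'

/-- Elementary binomial lower bound used for the format `(K², K)`: `K^j ≤ C(K² + j, j)` for `j ≤ K`
(each of the `j` factors `(K² + i)/i`, `i ≤ K`, is at least `K`). [folklore] -/
theorem pow_le_choose_sq_add (K : ℕ) : ∀ j : ℕ, j ≤ K → K ^ j ≤ Nat.choose (K ^ 2 + j) j := by
  intro j
  induction j with
  | zero => intro _; simp
  | succ j ih =>
    intro hj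
    have ih' := ih (by omega)
    have key : (K ^ 2 + j + 1) * Nat.choose (K ^ 2 + j) j = Nat.choose (K ^ 2 + j + 1) (j + 1) * (j + 1) :=
      Nat.add_one_mul_choose_eq (K ^ 2 + j) j
    have h1 : (j + 1) * K ^ (j + 1) ≤ (j + 1) * Nat.choose (K ^ 2 + j + 1) (j + 1) := by
      calc (j + 1) * K ^ (j + 1) = (j + 1) * K * K ^ j := by ring
        _ ≤ K * K * K ^ j := Nat.mul_le_mul_right _ (Nat.mul_le_mul_right _ (by omega))
        _ = K ^ 2 * K ^ j := by ring
        _ ≤ (K ^ 2 + j + 1) * Nat.choose (K ^ 2 + j) j := Nat.mul_le_mul (by omega) ih'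
        _ = Nat.choose (K ^ 2 + j + 1) (j + 1) * (j + 1) := key
        _ = (j + 1) * Nat.choose (K ^ 2 + j + 1) (j + 1) := by ring
    have h2 := Nat.le_of_mul_le_mul_left h1 (by omega : 0 < j + 1)
    rw [← add_assoc]
    exact h2

/-- **Format-level Descartes-extremality for all `(m, K)` refutes the crux.**  If for every `m, K ≥ 1` some
`K`-term real symmetric `m × m` lacunary pencil has `C(m+K−1, m) − 1` distinct positive zeros of its determinant
(the lower half of «`ζ_sym(m,K) = D(m,K)` for all formats»; the upper half is Descartes' rule), then
`MatrixDescartes` is false.  Proof: `MatrixDescartes` with `c = q = 2` at `K = 2^(K₀+2)`, `m = K²` gives a row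
`PosRootLawAt m K B` with `(2B+1)² ≤ 2^(K⌊log₂K⌋) = K^K`, whereas the hypothesis forces
`B ≥ C(K²+K−1, K−1) − 1 ≥ K^(K−1) − 1`, and `(K^(K−1))² > K^K` for `K ≥ 4`. [folklore] -/
theorem not_matrixDescartes_of_formatExtremal
    (hT : ∀ m K : ℕ, 1 ≤ m → 1 ≤ K → ¬ PosRootLawAt m K (Nat.choose (m + K - 1) m - 2)) :
    ¬ MatrixDescartes := by
  intro hMD
  obtain ⟨K₀, hK₀⟩ := (matrixDescartes_iff_posRootLaw.1 hMD) 2 2 (by norm_num)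
  -- the format: K = 2^(K₀+2), m = K²
  have hKpos : K₀ + 2 ≤ 2 ^ (K₀ + 2) := (Nat.lt_two_pow_self).le
  have hK4 : 4 ≤ 2 ^ (K₀ + 2) := by
    calc 4 = 2 ^ 2 := by norm_num
      _ ≤ 2 ^ (K₀ + 2) := Nat.pow_le_pow_right (by norm_num) (by omega)
  set K := 2 ^ (K₀ + 2) with hK
  have hlog : Nat.log 2 K = K₀ + 2 := by rw [hK]; exact Nat.log_pow (by norm_num) _
  have hm : K ^ 2 ≤ 2 ^ ((Nat.log 2 K + 2) ^ 2) := by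
    rw [hlog, hK, ← pow_mul]
    exact Nat.pow_le_pow_right (by norm_num) (by nlinarith)
  obtain ⟨B, hB, hBq⟩ := hK₀ K (K ^ 2) (by omega) hm
  -- the hypothesis at (m, K) = (K², K)
  have hnot := hT (K ^ 2) K (Nat.one_le_pow _ _ (by omega)) (by omega)
  have hBge : Nat.choose (K ^ 2 + K - 1) (K ^ 2) - 1 ≤ B := by
    by_contra hlt
    exact hnot (posRootLawAt_mono (by omega) hB)
  -- binomial symmetry and the lower bound K^(K−1) ≤ C(K² + (K−1), K−1)
  have hKm1 : K ^ 2 + K - 1 = (K - 1) + K ^ 2 := by omega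
  have hch : Nat.choose (K ^ 2 + K - 1) (K ^ 2) = Nat.choose (K ^ 2 + (K - 1)) (K - 1) := by
    rw [hKm1, ← Nat.choose_symm_add, Nat.add_comm (K - 1) (K ^ 2)]
  have hlow : K ^ (K - 1) ≤ Nat.choose (K ^ 2 + (K - 1)) (K - 1) :=
    pow_le_choose_sq_add K (K - 1) (by omega)
  have hlow' : K ^ (K - 1) ≤ Nat.choose (K ^ 2 + K - 1) (K ^ 2) := hch ▸ hlow
  have h2B : K ^ (K - 1) ≤ 2 * B + 1 := by omega
  -- the crux's cap: (2B+1)² ≤ 2^(K log K) = K^K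
  have hpow : 2 ^ (K * Nat.log 2 K) = K ^ K := by
    rw [hlog, hK, ← pow_mul, mul_comm]
  have hcap : (K ^ (K - 1)) ^ 2 ≤ K ^ K := by
    calc (K ^ (K - 1)) ^ 2 ≤ (2 * B + 1) ^ 2 := Nat.pow_le_pow_left h2B 2
      _ ≤ 2 ^ (K * Nat.log 2 K) := hBq
      _ = K ^ K := hpow
  -- but (K^(K−1))² = K^(2K−2) > K^K for K ≥ 4
  have h1K : 1 < K := by omega
  have hexp : K < (K - 1) * 2 := by omega
  have hsq : (K ^ (K - 1)) ^ 2 = K ^ ((K - 1) * 2) := (pow_mul K (K - 1) 2).symm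
  have hlt : K ^ K < (K ^ (K - 1)) ^ 2 := by
    rw [hsq]
    exact Nat.pow_lt_pow_right h1K hexp
  exact absurd hcap (not_le.2 hlt)

/-- **Sharper fork (theory g3, CONJECTURE v1.9.3 §1 «fork window», simplest instance): Descartes-extremality along the
square tower `(K², K)`, `K ≥ 4`, already refutes the crux.**  Only the formats `(m, K) = (K², K)` are used by the fork
argument, so `MatrixDescartes` forces `ζ_sym(K², K) ≤ C(K²+K−1, K²) − 2` (Descartes-DEFICIENCY) for every large power of
two `K` — formats far outside the census (`K = 4`: `(16, 4)`).  Same proof as `not_matrixDescartes_of_formatExtremal`. [folklore] -/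
theorem not_matrixDescartes_of_squareTowerExtremal
    (hT : ∀ K : ℕ, 4 ≤ K → ¬ PosRootLawAt (K ^ 2) K (Nat.choose (K ^ 2 + K - 1) (K ^ 2) - 2)) :
    ¬ MatrixDescartes := by
  intro hMD
  obtain ⟨K₀, hK₀⟩ := (matrixDescartes_iff_posRootLaw.1 hMD) 2 2 (by norm_num)
  have hKpos : K₀ + 2 ≤ 2 ^ (K₀ + 2) := (Nat.lt_two_pow_self).le
  have hK4 : 4 ≤ 2 ^ (K₀ + 2) := by
    calc 4 = 2 ^ 2 := by norm_num
      _ ≤ 2 ^ (K₀ + 2) := Nat.pow_le_pow_right (by norm_num) (by omega)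
  set K := 2 ^ (K₀ + 2) with hK
  have hlog : Nat.log 2 K = K₀ + 2 := by rw [hK]; exact Nat.log_pow (by norm_num) _
  have hm : K ^ 2 ≤ 2 ^ ((Nat.log 2 K + 2) ^ 2) := by
    rw [hlog, hK, ← pow_mul]
    exact Nat.pow_le_pow_right (by norm_num) (by nlinarith)
  obtain ⟨B, hB, hBq⟩ := hK₀ K (K ^ 2) (by omega) hm
  have hnot := hT K hK4
  have hBge : Nat.choose (K ^ 2 + K - 1) (K ^ 2) - 1 ≤ B := by
    by_contra hlt
    exact hnot (posRootLawAt_mono (by omega) hB)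
  have hKm1 : K ^ 2 + K - 1 = (K - 1) + K ^ 2 := by omega
  have hch : Nat.choose (K ^ 2 + K - 1) (K ^ 2) = Nat.choose (K ^ 2 + (K - 1)) (K - 1) := by
    rw [hKm1, ← Nat.choose_symm_add, Nat.add_comm (K - 1) (K ^ 2)]
  have hlow : K ^ (K - 1) ≤ Nat.choose (K ^ 2 + (K - 1)) (K - 1) :=
    pow_le_choose_sq_add K (K - 1) (by omega)
  have hlow' : K ^ (K - 1) ≤ Nat.choose (K ^ 2 + K - 1) (K ^ 2) := hch ▸ hlow
  have h2B : K ^ (K - 1) ≤ 2 * B + 1 := by omega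
  have hpow : 2 ^ (K * Nat.log 2 K) = K ^ K := by
    rw [hlog, hK, ← pow_mul, mul_comm]
  have hcap : (K ^ (K - 1)) ^ 2 ≤ K ^ K := by
    calc (K ^ (K - 1)) ^ 2 ≤ (2 * B + 1) ^ 2 := Nat.pow_le_pow_left h2B 2
      _ ≤ 2 ^ (K * Nat.log 2 K) := hBq
      _ = K ^ K := hpow
  have h1K : 1 < K := by omega
  have hexp : K < (K - 1) * 2 := by omega
  have hsq : (K ^ (K - 1)) ^ 2 = K ^ ((K - 1) * 2) := (pow_mul K (K - 1) 2).symm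
  have hlt : K ^ K < (K ^ (K - 1)) ^ 2 := by
    rw [hsq]
    exact Nat.pow_lt_pow_right h1K hexp
  exact absurd hcap (not_le.2 hlt)

/-- Hence `MatrixDescartes` FORCES Descartes-deficiency somewhere on the square tower: some format `(K², K)` with `K ≥ 4`
satisfies the row `ζ_sym(K², K) ≤ C(K²+K−1, K²) − 2 < D(K², K)`. [folklore] -/
theorem exists_squareTower_deficient_of_matrixDescartes (h : MatrixDescartes) :
    ∃ K : ℕ, 4 ≤ K ∧ PosRootLawAt (K ^ 2) K (Nat.choose (K ^ 2 + K - 1) (K ^ 2) - 2) := by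
  by_contra hne
  push Not at hne
  exact not_matrixDescartes_of_squareTowerExtremal (fun K hK => hne K hK) h

end Summit.ValiantsHypothesis.ValiantsHypothesis.Theorems.LacunarySymmetroidMatrixDescartes.Census
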